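import Summits.SmoothPoincare4.SmoothPoincare4.Theorems.CongruenceShadowsNormalFormStablyTrivialSketchConsequences
import Summits.SmoothPoincare4.SmoothPoincare4.Theorems.CongruenceShadowsGenusZero
import Summits.SmoothPoincare4.SmoothPoincare4.Theorems.CongruenceShadowsGateLogic

/-!
# `NormalFormStablyTrivial` — line `Sketch`: the LOGICAL POSITION of its two stubs (cycle 2 record)

Support file of the proof line `Sketch` (crux idea `primitive-reducing-systems`) for the crux
`CongruenceShadows.NormalFormStablyTrivial` (item stmt-SmoothPoincare4-14591, route
route-SmoothPoincare4-CongruenceShadows; registered skeleton `Cruxes/NormalFormStablyTrivial/Lines/Sketch.lean`,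
stubs `StablyThreeHandleFree` (K1) and `ThreeHandleFreeStablyTrivial` (K2) of
`…SketchTransfer.lean`).  Nothing here is a research step: the file records, as kernel-checked
implications between EXISTING route items and the two stubs, the line lead's cycle-2 verdict that the
stubs have exactly the strength of the crux — so that no later seat re-derives it and the planner can
read the position off one module.

* `agkCondition_of_normalFormStablyTrivial` — crux ∧ `WaldhausenPairs` ⇒ Abrams–Gay–Kirby's condition
  `X` ("every `(3k, k)` group trisection of the trivial group is stably trivial"): the `k`-induction of
  the route's deciding theorem `closes`, stopped before `AgkCor6Sufficiency`, with the `k = 0` case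
  DISCHARGED by the proved item `GenusZero_proof` (stmt-SmoothPoincare4-14598).
* `normalFormStablyTrivial_of_agkCondition` — `X` ⇒ crux, through the line: `X ⇒ K1`
  (`stablyThreeHandleFree_of_agkCondition`), `X ⇒ K2` (`threeHandleFreeStablyTrivial_of_agkCondition`),
  `K1 ∧ K2 ⇒ crux` (`transfer_normalFormStablyTrivial`).
* `stubs_iff_normalFormStablyTrivial` — **given `WaldhausenPairs`, `K1 ∧ K2 ↔ crux`**, and
  `agkCondition_iff_normalFormStablyTrivial` — given `WaldhausenPairs`, `X ↔ crux`.  So the line's cut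
  has no slack: each stub is implied by SPC4 (through `X`) and the pair returns the crux; K1 is the
  kernel form of Kirby's Problem 4.18 for homotopy 4-spheres (route NoOneHandles' `NoohNoOneHandles`),
  K2 the kernel form of weak generalised Property R (`NoohGscStandard`).
* `stablyThreeHandleFree_of_shadows`, `threeHandleFreeStablyTrivial_of_shadows` — the route's own load
  path already carries both stubs: `ShadowsStandard ∧ ShadowApproximation` (items 14593, 14595) give K1
  outright (through the proved gate `GateLogic_proof`, item 14597, and the calibration) and, with
  `WaldhausenPairs`, K2.  This is the formal content of the lead's outcome
  `blocked-on: stmt-SmoothPoincare4-14595`.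

Sources: A. Abrams, D. Gay, R. Kirby, *Group trisections and smooth 4-manifolds*, Geom. Topol. 22
(2018), Cor. 6; R. Kirby, *Problems in low-dimensional topology* (1997), 4.18; R. Gompf,
M. Scharlemann, A. Thompson, Geom. Topol. 14 (2010), Prop. 9.2 (weak generalised Property R).
-/

noncomputable section

-- the prescribed namespace `Summit.<P>.<Sub>.…` duplicates `SmoothPoincare4` (P = Sub)
set_option linter.dupNamespace false

namespace Summit.SmoothPoincare4.SmoothPoincare4.Theorems.NormalFormStablyTrivial.Sketch

open Literature.Topology.FourManifolds Subgroup
open Summit.SmoothPoincare4.SmoothPoincare4.Theses.CongruenceShadows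
  (NormalFormStablyTrivial WaldhausenPairs ShadowsStandard ShadowApproximation)
open Summit.SmoothPoincare4.SmoothPoincare4.Theorems (GenusZero_proof GateLogic_proof)
open Summit.SmoothPoincare4.SmoothPoincare4.Theorems.AgkCor6Sufficiency.Negative (iso_cast_iff)

/-- **crux ∧ `WaldhausenPairs` ⇒ AGK's condition `X`.**  For `k = 0` the proved item `GenusZero`;
for `k = m + 1` transport along `3 (m + 1) = 3 + 3 m` (a `subst` on a generalised genus),
normalise the three Heegaard pairs by `WaldhausenPairs`, and apply the crux. [folklore] -/
theorem agkCondition_of_normalFormStablyTrivial (hW : WaldhausenPairs) (hX : NormalFormStablyTrivial)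
    (k : ℕ) (K : TrisectionKernels (3 * k)) (hK : IsGroupTrisection (3 * k) k (PUnit : Type) K) :
    K.IsStablyTrivial := by
  cases k with
  | zero => exact GenusZero_proof K hK
  | succ m =>
    have key : ∀ (g : ℕ) (K' : TrisectionKernels g), g = 3 + 3 * m →
        IsGroupTrisection g (m + 1) (PUnit : Type) K' → K'.IsStablyTrivial := by
      intro g K' hg hK'
      subst hg
      exact hX m K' hK' (hW m K' hK')
    exact key (3 * (m + 1)) K (by ring) hK

/-- **AGK's condition `X` ⇒ crux, through the line `Sketch`**: `X ⇒ K1`, `X ⇒ K2`, and the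
transfer `K1 ∧ K2 ⇒ crux`. [folklore] -/
theorem normalFormStablyTrivial_of_agkCondition
    (hX : ∀ (k : ℕ) (K : TrisectionKernels (3 * k)),
      IsGroupTrisection (3 * k) k (PUnit : Type) K → K.IsStablyTrivial) :
    NormalFormStablyTrivial :=
  transfer_normalFormStablyTrivial (stablyThreeHandleFree_of_agkCondition hX)
    (threeHandleFreeStablyTrivial_of_agkCondition hX)

/-- **crux ∧ `WaldhausenPairs` ⇒ both stubs of the line.** [folklore] -/
theorem stubs_of_normalFormStablyTrivial (hW : WaldhausenPairs) (hX : NormalFormStablyTrivial) :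
    StablyThreeHandleFree ∧ ThreeHandleFreeStablyTrivial :=
  ⟨stablyThreeHandleFree_of_agkCondition (agkCondition_of_normalFormStablyTrivial hW hX),
    threeHandleFreeStablyTrivial_of_agkCondition (agkCondition_of_normalFormStablyTrivial hW hX)⟩

/-- **Given `WaldhausenPairs`, the two stubs of line `Sketch` are jointly EQUIVALENT to the crux**
(`→` is the registered transfer and needs nothing; `←` goes through AGK's condition).  The line's
cut `K1 ∧ K2` therefore has exactly the strength of the crux: K1 (= Kirby 4.18 for homotopy
4-spheres, kernel form) and K2 (= weak generalised Property R, kernel form) are each consequences of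
SPC4 and together return it. [folklore] -/
theorem stubs_iff_normalFormStablyTrivial (hW : WaldhausenPairs) :
    (StablyThreeHandleFree ∧ ThreeHandleFreeStablyTrivial) ↔ NormalFormStablyTrivial :=
  ⟨fun h => transfer_normalFormStablyTrivial h.1 h.2, stubs_of_normalFormStablyTrivial hW⟩

/-- **Given `WaldhausenPairs`, AGK's condition `X` is EQUIVALENT to the crux** (the normal-form
hypothesis costs nothing and gives nothing). [folklore] -/
theorem agkCondition_iff_normalFormStablyTrivial (hW : WaldhausenPairs) :
    (∀ (k : ℕ) (K : TrisectionKernels (3 * k)),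
      IsGroupTrisection (3 * k) k (PUnit : Type) K → K.IsStablyTrivial) ↔ NormalFormStablyTrivial :=
  ⟨normalFormStablyTrivial_of_agkCondition, agkCondition_of_normalFormStablyTrivial hW⟩

/-- **The route's load path gives K1 outright**: under `ShadowsStandard ∧ ShadowApproximation`
(items 14593, 14595) every normalised `(3+3m, m+1)` trisection of `{1}` is stably trivial with no
stabilisation (the proved gate `GateLogic_proof`), and a stably trivial triple satisfies the conclusion
of K1 by the calibration "the standard triple is a one-direction connected sum" (the isomorphisms
compose at one genus; no Nielsen lifting). [folklore] -/
theorem stablyThreeHandleFree_of_shadows (hS : ShadowsStandard) (hA : ShadowApproximation) :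
    StablyThreeHandleFree := by
  intro m K hK hP
  obtain ⟨n, m', h', hiso⟩ := GateLogic_proof hS hA m K hK hP
  have hm : m' = m + n := by omega
  subst hm
  have h : 3 + 3 * m + 3 * n = 2 * (m + 1 + n) + (m + 1 + n) := by omega
  obtain ⟨K'', hK''⟩ := calibration (m + n) (m + 1 + n) (by omega) (h'.trans h)
  refine ⟨n, 0, K'', h, ?_⟩
  -- compose `hiso` (at genus `3+3m+3n`) with the calibration, across the cast `h`
  have hiso' : TrisectionKernels.Iso ((K.stabilizeIter n).cast h)
      (((s4Kernels.stabilizeIter (m + n)).cast h').cast h) := (iso_cast_iff h _ _).2 hiso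
  rw [AgkCor6Sufficiency.Negative.cast_cast] at hiso'
  obtain ⟨α, hα⟩ := hiso'
  obtain ⟨β, hβ⟩ := hK''
  refine ⟨α.trans β, fun i => ?_⟩
  rw [show (α.trans β).toMonoidHom = β.toMonoidHom.comp α.toMonoidHom from rfl, ← Subgroup.map_map,
    hα, hβ]

/-- **The route's load path, with `WaldhausenPairs`, gives K2**: `ShadowsStandard ∧
ShadowApproximation ⇒ crux` (`GateLogic_proof`) `⇒ X` (`agkCondition_of_normalFormStablyTrivial`)
`⇒ K2`.  Formal content of the lead's outcome `blocked-on: stmt-SmoothPoincare4-14595`: once the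
route's rungs land, both stubs and the crux close at once. [folklore] -/
theorem threeHandleFreeStablyTrivial_of_shadows (hW : WaldhausenPairs) (hS : ShadowsStandard)
    (hA : ShadowApproximation) : ThreeHandleFreeStablyTrivial :=
  threeHandleFreeStablyTrivial_of_agkCondition
    (agkCondition_of_normalFormStablyTrivial hW (GateLogic_proof hS hA))

end Summit.SmoothPoincare4.SmoothPoincare4.Theorems.NormalFormStablyTrivial.Sketch

end
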